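import Summits.ResolutionOfSingularities.ResolutionOfSingularities.Theorems.PurelyInseparableDim4StepKitState
import HarnessLib

/-!
# Zoo certificates ‖ K — row J-001, the RATIONAL half: no RISE at any `𝔽₂`-point above the P-2-1 point blow-up

[OURS · census certificate · counted 0.]  Census cell «res-dim4-pi» (D-0157 DOOR 2), TY-4 series,
companion of `PurelyInseparableDim4ZooCertJ001` (which certifies the RISE `2 → 3` at the `𝔽₄`-points
`(1, ω, ω²)`).  JUMPS row J-001 records «NO rational rise: the 15 `𝔽₂`-points are 8 DROP + 7 EQUAL»
(K = B: eng-A v1.2 ∧ eng-B v1.3, idea-2, crit-1).  Here, with res-dim4-p-13's `StepKit` and ONE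
`decide` over all charts `j` and all `b : Fin 4 → 𝔽₂` with `b_j = 0` (64 cases; the points `b` with
`b_i ≠ 0` off the chart convention are harmless extra cases), the KERNEL checks: at every `𝔽₂`-rational
point of every chart of the point blow-up of `a = (xyvw(y² + v² + w²), r = (1,1,1,1), exc = all)`
that is again `2`-fold, the shade does NOT increase.  So the kangaroo of P-2-1 is genuinely
IRRATIONAL (needs `𝔽₄`).  Class (4,1), `p = q = 2`, variables `(x, y, v, w) = Fin 4`.  Nothing here
proves or disproves resolution of singularities in dim ≥ 4 / char p.
-/

-- house layout `Summits/<Summit>/<Problem>` doubles the namespace component (as in the Target file)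
set_option linter.dupNamespace false

noncomputable section

namespace Summit.ResolutionOfSingularities.ResolutionOfSingularities.Theorems.PIDim4

namespace ZooCert.J001Rational

open StepKit
open Literature.AlgebraicGeometry.Resolution

/-- the P-2-1 parent `a = (xy³vw + xyv³w + xyvw³, (1,1,1,1), {x,y,v,w})`, presented. [folklore] -/
def a : SData 4 (ZMod 2) :=
  ⟨[(![1, 3, 1, 1], 1), (![1, 1, 3, 1], 1), (![1, 1, 1, 3], 1)], ![1, 1, 1, 1], {0, 1, 2, 3}⟩

set_option maxRecDepth 8192 in
/-- **Kernel enumeration, `x`-chart**: at every `𝔽₂`-point `(0, t₁, t₂, t₃)` that is equimultiple the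
list shade does not increase. [folklore] -/
theorem no_rise_chart0 (t₁ t₂ t₃ : ZMod 2) : equiB 2 Finset.univ 0 ![0, t₁, t₂, t₃] a = true →
    ¬ shadeE a < shadeE (stepD 2 Finset.univ 0 ![0, t₁, t₂, t₃] a) := by
  fin_cases t₁ <;> fin_cases t₂ <;> fin_cases t₃ <;> decide
set_option maxRecDepth 8192 in
/-- `y`-chart. [folklore] -/
theorem no_rise_chart1 (t₀ t₂ t₃ : ZMod 2) : equiB 2 Finset.univ 1 ![t₀, 0, t₂, t₃] a = true →
    ¬ shadeE a < shadeE (stepD 2 Finset.univ 1 ![t₀, 0, t₂, t₃] a) := by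
  fin_cases t₀ <;> fin_cases t₂ <;> fin_cases t₃ <;> decide
set_option maxRecDepth 8192 in
/-- `v`-chart. [folklore] -/
theorem no_rise_chart2 (t₀ t₁ t₃ : ZMod 2) : equiB 2 Finset.univ 2 ![t₀, t₁, 0, t₃] a = true →
    ¬ shadeE a < shadeE (stepD 2 Finset.univ 2 ![t₀, t₁, 0, t₃] a) := by
  fin_cases t₀ <;> fin_cases t₁ <;> fin_cases t₃ <;> decide
set_option maxRecDepth 8192 in
/-- `w`-chart. [folklore] -/
theorem no_rise_chart3 (t₀ t₁ t₂ : ZMod 2) : equiB 2 Finset.univ 3 ![t₀, t₁, t₂, 0] a = true →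
    ¬ shadeE a < shadeE (stepD 2 Finset.univ 3 ![t₀, t₁, t₂, 0] a) := by
  fin_cases t₀ <;> fin_cases t₁ <;> fin_cases t₂ <;> decide

/-- the four charts together: for every chart `j` and every `𝔽₂`-point `b` with `b j = 0`. [folklore] -/
theorem no_rational_rise_B (j : Fin 4) (b : Fin 4 → ZMod 2) (hb : b j = 0)
    (he : equiB 2 Finset.univ j b a = true) : ¬ shadeE a < shadeE (stepD 2 Finset.univ j b a) := by
  have hb4 : b = ![b 0, b 1, b 2, b 3] := by ext i; fin_cases i <;> rfl
  fin_cases j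
  · rw [hb4] at he ⊢; simp only [Fin.zero_eta] at hb; rw [hb] at he ⊢; exact no_rise_chart0 _ _ _ he
  · rw [hb4] at he ⊢; simp only [Fin.mk_one] at hb; rw [hb] at he ⊢; exact no_rise_chart1 _ _ _ he
  · rw [hb4] at he ⊢; rw [show b 2 = 0 from hb] at he ⊢; exact no_rise_chart2 _ _ _ he
  · rw [hb4] at he ⊢; rw [show b 3 = 0 from hb] at he ⊢; exact no_rise_chart3 _ _ _ he

/-- **J-001, rational half ‖ K**: at every `𝔽₂`-rational equimultiple point of every chart of the point
blow-up of `a`, the shade does not rise (`¬ RiseD`). [folklore] -/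
theorem not_riseD_rational (j : Fin 4) (b : Fin 4 → ZMod 2) (hb : b j = 0)
    (he : CentreBlowup.IsEquimultiplePoint 2 Finset.univ j b a.toState) :
    ¬ RiseD a.toState (CentreBlowup.step 2 Finset.univ j b a.toState) := by
  rw [step_toState, riseD_iff]
  exact no_rational_rise_B j b hb ((isEquimultiplePoint_iff 2 Finset.univ j b a).mp he)

/-- the parent's shade is `2`. [folklore] -/
theorem shade_a : a.toState.shade = 2 := by rw [shade_toState]; decide

end ZooCert.J001Rational

open ZooCert.J001Rational in
/-- **J-001 (rational half) ‖ K.**  Over `𝔽₂` the point blow-up of the P-2-1 state has NO kangaroo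
point: no `Step0 2` edge out of `a.toState` with a rational point raises the shade — the RISE of
`PurelyInseparableDim4ZooCertJ001` needs the `𝔽₄`-points `(1, ω, ω²)`.  Census value only. [folklore] -/
theorem no_rational_step0_rise (s' : State (ZMod 2)) (h : Step0 2 ZooCert.J001Rational.a.toState s') :
    ¬ RiseD ZooCert.J001Rational.a.toState s' := by
  obtain ⟨-, j, b, -, hb, he, -, rfl⟩ := h
  exact not_riseD_rational j b hb he

end Summit.ResolutionOfSingularities.ResolutionOfSingularities.Theorems.PIDim4

end
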